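import Summits.Ventures.PercRepro0.Events

/-! # The continuity bridge: from monotonicity / right-continuity of θ_d to `T d`

Lemmas about the objects of `Defs.lean` (PROVED-HERE, no literature; seat p5); MEMO-p5-v1 §2, Thm 2.6 / Cor 2.7:

* under monotonicity of `θ_d` on `[0,1]` (the conclusion of L1): `theta_pos_of_pc_lt` and `pc_eq_sSup_zeroSet`
  (inf form = sup form of `p_c(d)`, the route's L0 · PC-FORMS);
* under right-continuity of `θ_d` at `p_c(d)` (the conclusion of L2): `T d ↔ θ_d(p) → 0 as p ↓ p_c(d)`; an eventual upper bound
  `θ_d ≤ g` with `g → 0` gives `T d`; a linear bound `θ_d(p) ≤ C (p − p_c)` on `(p_c, p_c + ε)` gives `T d`;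
* assembly: `T d` from `L2_RightCont d`, `H2_TriangleImpliesBeta d`, the triangle condition at `p_c(d)` and `p_c(d) < 1`;
  `THD` from `H1_Triangle11` and the same inputs for every `d ≥ 11`; `T_iff_tendsto_toBoundary` (R_MID-1, first half).
-/

namespace Summit.Ventures.PercRepro0.Defs

open MeasureTheory ProbabilityTheory unitInterval Filter
open scoped ENNReal Topology

variable {d : ℕ}

/-! ### Consequences of monotonicity (the conclusion of L1) -/

/-- L1 gives that `θ_d` is non-decreasing on `[0,1]`. -/
theorem monotoneOn_theta_of_L1 (h : L1_Monotone d) : MonotoneOn (theta d) (Set.Icc 0 1) := by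
  intro p _ q _ hpq
  unfold theta thetaI
  have hle : P d (clamp p) (percolates d) ≤ P d (clamp q) (percolates d) :=
    h (clamp p) (clamp q) (Set.monotone_projIcc zero_le_one hpq) (percolates d)
      isUpperSet_percolates measurableSet_percolates
  exact ENNReal.toReal_mono (measure_ne_top _ _) hle

/-- Above `p_c(d)` the percolation probability is positive (given monotonicity, `d ≥ 1`). -/
theorem theta_pos_of_pc_lt (hd : 1 ≤ d) (hmono : MonotoneOn (theta d) (Set.Icc 0 1))
    {p : ℝ} (hp : pc d < p) (hp1 : p ≤ 1) : 0 < theta d p := by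
  obtain ⟨q, hq, hqp⟩ := exists_lt_of_csInf_lt ⟨1, one_mem_pcSet hd⟩ hp
  have hp0 : 0 ≤ p := hq.1.1.trans hqp.le
  exact lt_of_lt_of_le hq.2 (hmono hq.1 ⟨hp0, hp1⟩ hqp.le)

/-- `0 ∈ zeroSet d`. -/
theorem zero_mem_zeroSet : (0 : ℝ) ∈ zeroSet d := ⟨⟨le_rfl, zero_le_one⟩, theta_zero⟩

/-- `zeroSet d` is bounded above by `1`. -/
theorem zeroSet_bddAbove : BddAbove (zeroSet d) := ⟨1, fun _ hp => hp.1.2⟩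

/-- Inf form = sup form: `p_c(d) = sup { p ∈ [0,1] : θ_d(p) = 0 }` (given monotonicity, `d ≥ 1`).
This reconciles ROUTE-v1 §0 with the `sup` definition used in MEMO-p5-v1 §1. -/
theorem pc_eq_sSup_zeroSet (hd : 1 ≤ d) (hmono : MonotoneOn (theta d) (Set.Icc 0 1)) :
    pc d = sSup (zeroSet d) := by
  apply le_antisymm
  · rcases le_or_gt (pc d) (sSup (zeroSet d)) with hle | hlt
    · exact hle
    exfalso
    set b := sSup (zeroSet d) with hb
    have hb0 : 0 ≤ b := le_csSup zeroSet_bddAbove zero_mem_zeroSet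
    set p := (pc d + b) / 2 with hp
    have hbp : b < p := by rw [hp]; linarith
    have hppc : p < pc d := by rw [hp]; linarith
    have hp0 : 0 ≤ p := by rw [hp]; linarith [pc_nonneg (d := d)]
    have hp1 : p ≤ 1 := by linarith [pc_le_one hd]
    have hpz : p ∈ zeroSet d := ⟨⟨hp0, hp1⟩, theta_eq_zero_of_lt_pc hd hp0 hppc⟩
    have : p ≤ b := le_csSup zeroSet_bddAbove hpz
    exact absurd hbp (not_lt.2 this)
  · refine csSup_le ⟨0, zero_mem_zeroSet⟩ fun p hp => ?_
    refine le_csInf ⟨1, one_mem_pcSet hd⟩ fun q hq => ?_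
    rcases le_or_gt p q with hpq | hqp
    · exact hpq
    exfalso
    have : theta d q ≤ theta d p := hmono hq.1 hp.1 hqp.le
    rw [hp.2] at this
    exact absurd hq.2 (not_lt.2 this)

/-! ### The continuity bridge (MEMO-p5-v1 §2, Thm 2.6 / Cor 2.7) -/

/-- Under right-continuity of `θ_d` at `p_c(d)`: `T d ⟺ θ_d(p) → 0 as p ↓ p_c(d)`. -/
theorem T_iff_tendsto_of_rightCont
    (hrc : ContinuousWithinAt (theta d) (Set.Ioi (pc d)) (pc d)) :
    T d ↔ Tendsto (theta d) (𝓝[>] (pc d)) (𝓝 0) := by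
  constructor
  · intro hT
    have h := hrc.tendsto
    rw [T_iff] at hT
    rw [hT] at h
    exact h
  · intro h
    exact tendsto_nhds_unique hrc.tendsto h

/-- Under right-continuity at `p_c(d)`, an eventual upper bound `θ_d ≤ g` with `g → 0` forces `T d`. -/
theorem T_of_eventually_le_of_rightCont
    (hrc : ContinuousWithinAt (theta d) (Set.Ioi (pc d)) (pc d))
    {g : ℝ → ℝ} (hg : Tendsto g (𝓝[>] (pc d)) (𝓝 0))
    (hle : ∀ᶠ p in 𝓝[>] (pc d), theta d p ≤ g p) : T d := by
  rw [T_iff_tendsto_of_rightCont hrc]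
  exact tendsto_of_tendsto_of_tendsto_of_le_of_le' tendsto_const_nhds hg
    (Eventually.of_forall fun p => theta_nonneg d p) hle

/-- Under right-continuity at `p_c(d)`, a linear bound `θ_d(p) ≤ C (p − p_c(d))` on `(p_c, p_c + ε)`
forces `T d` (Cor 2.7 of MEMO-p5-v1). -/
theorem T_of_linear_bound_of_rightCont
    (hrc : ContinuousWithinAt (theta d) (Set.Ioi (pc d)) (pc d))
    {C ε : ℝ} (hε : 0 < ε)
    (hb : ∀ p : ℝ, pc d < p → p < pc d + ε → theta d p ≤ C * (p - pc d)) : T d := by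
  refine T_of_eventually_le_of_rightCont hrc (g := fun p => C * (p - pc d)) ?_ ?_
  · have h : Tendsto (fun p : ℝ => C * (p - pc d)) (𝓝 (pc d)) (𝓝 (C * (pc d - pc d))) :=
      (continuous_const.mul (continuous_id.sub continuous_const)).tendsto (pc d)
    rw [sub_self, mul_zero] at h
    exact tendsto_nhdsWithin_of_tendsto_nhds h
  · have hmem : Set.Ioo (pc d) (pc d + ε) ∈ 𝓝[>] (pc d) :=
      Ioo_mem_nhdsGT (by simpa using hε)
    exact Filter.eventually_of_mem hmem fun p hp => hb p hp.1 hp.2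

/-- Right-continuity at `p_c(d)` from L2 (needs `p_c(d) < 1`). -/
theorem rightCont_at_pc_of_L2 (hL2 : L2_RightCont d) (hpc : pc d < 1) :
    ContinuousWithinAt (theta d) (Set.Ioi (pc d)) (pc d) :=
  hL2.2 (pc d) pc_nonneg hpc

/-- H3 (β-form assembly): `T d` from L2, H2 and the triangle condition at `p_c(d)`, given `p_c(d) < 1`. -/
theorem T_of_L2_H2_triangle (hL2 : L2_RightCont d) (hH2 : H2_TriangleImpliesBeta d)
    (hTri : TriangleCondition d (clamp (pc d))) (hpc : pc d < 1) : T d := by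
  obtain ⟨C, ε, hε, hb⟩ := hH2 hTri
  exact T_of_linear_bound_of_rightCont (rightCont_at_pc_of_L2 hL2 hpc) hε hb

/-- T_HD from H1, H2 and L2 for every `d ≥ 11` (plus `p_c(d) < 1` there). -/
theorem THD_of_H1_H2_L2 (hH1 : H1_Triangle11) (hH2 : ∀ d : ℕ, 11 ≤ d → H2_TriangleImpliesBeta d)
    (hL2 : ∀ d : ℕ, 11 ≤ d → L2_RightCont d) (hpc : ∀ d : ℕ, 11 ≤ d → pc d < 1) : THD :=
  fun d hd => T_of_L2_H2_triangle (hL2 d hd) (hH2 d hd) (hH1 d hd) (hpc d hd)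

/-- R_MID-1, first half: under the finite-box limit of L2 at `p_c(d)`,
`T d ⟺ P_{p_c}(0 ↔ ∂Λ_n) → 0`. -/
theorem T_iff_tendsto_toBoundary
    (h : Tendsto (fun n : ℕ => (P d (clamp (pc d)) (toBoundary d n)).toReal) atTop
      (𝓝 (thetaI d (clamp (pc d))))) :
    T d ↔ Tendsto (fun n : ℕ => (P d (clamp (pc d)) (toBoundary d n)).toReal) atTop (𝓝 0) := by
  constructor
  · intro hT
    have hT' : thetaI d (clamp (pc d)) = 0 := hT
    rw [hT'] at h
    exact h
  · intro h0
    exact tendsto_nhds_unique h h0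

end Summit.Ventures.PercRepro0.Defs
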